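import Summits.NavierStokesRegularity.NavierStokesRegularity.Theses.AxisymmetricExtremality
import Literature.Analysis.FluidPDE.CriticalSpaces
import Literature.Analysis.FluidPDE.AxisymmetricEuler

/-!
# Route AxisymmetricExtremality — crux `MinimalDatumPFold` (stmt-NavierStokesRegularity-15452), stub `stub_liftScaleRigidity`

Registered stub of the line `registered` (`Cruxes/MinimalDatumPFold/Lines/birth.lean`, lead c1 reshape).
Target tree file: `Summits/NavierStokesRegularity/NavierStokesRegularity/Theorems/AxisymmetricExtremalityMinimalDatumPFoldScaleRigidity.lean`.

**Scale rigidity.** If a non-trivial `L³` velocity field `u₀` is fixed, modulo the similarity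
`x ↦ λ R x − x₀` (`R` the rotation by `2π/p` about the `x₂`-axis, `λ > 0`), by the Navier–Stokes
rescaling, `λ u₀ (λ R x − x₀) = R (u₀ x)` a.e., then `λ = 1`.

Proof (pure real analysis, [folklore]): suppose `λ ≠ 1`. Taking norms (`R` is an isometry),
`‖u₀ x‖³ = λ³ ‖u₀ (B x)‖³` a.e. with the affine similarity `B x = λ R x − x₀` of ratio `λ`, whose
Jacobian `λ³` exactly compensates: the finite measure `ν(A) = ∫_A ‖u₀‖³` satisfies
`ν (B⁻¹ A) = ν A`. Since `λ ≠ 1`, `λ R − 1` is injective hence surjective (finite dimension), so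
`B` has a fixed point `x*`, and `B⁻¹ (ball x* r) = ball x* (r/λ)`; iterating along the contracting
direction, continuity from above of the finite measure `ν` (absolutely continuous, so `ν {x*} = 0`)
forces `ν (ball x* r) = 0` for every `r > 0`, hence `ν = 0` and `u₀ = 0` a.e., a contradiction.
The rotation enters only through an abstract linear isometry equivalence `R : ℝ³ ≃ₗᵢ[ℝ] ℝ³`
(`scaleRigidity_ae_eq_zero`), instantiated with `Literature.Analysis.FluidPDE.rotZ (2π/p)`.
-/

set_option linter.dupNamespace false

noncomputable section

open MeasureTheory Set Function Filter Topology
open scoped ENNReal NNReal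

namespace Summit.NavierStokesRegularity.NavierStokesRegularity.Theorems

/-- **Jacobian bookkeeping for a similarity.** For a linear isometry equivalence `R` of `ℝ³`,
`λ > 0`, `x₀ ∈ ℝ³` and the affine similarity `B x = λ R x − x₀`: if `λ u₀ (B x) = R (u₀ x)` a.e.,
then the cubic mass `A ↦ ∫⁻_A ‖u₀‖ₑ³` is `B`-invariant, `∫⁻_{B⁻¹ A} ‖u₀‖ₑ³ = ∫⁻_A ‖u₀‖ₑ³`
(change of variables: `B_* vol = λ⁻³ vol`, while `‖u₀‖ₑ³ = λ³ ‖u₀ ∘ B‖ₑ³` a.e.). [folklore] -/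
theorem scaleRigidity_setLIntegral_preimage_eq
    (R : EuclideanSpace ℝ (Fin 3) ≃ₗᵢ[ℝ] EuclideanSpace ℝ (Fin 3))
    (u₀ : EuclideanSpace ℝ (Fin 3) → EuclideanSpace ℝ (Fin 3)) {lam : ℝ} (hlam : 0 < lam)
    (x₀ : EuclideanSpace ℝ (Fin 3))
    (h : ∀ᵐ x ∂(volume : Measure (EuclideanSpace ℝ (Fin 3))), lam • u₀ (lam • R x - x₀) = R (u₀ x))
    (A : Set (EuclideanSpace ℝ (Fin 3))) :
    ∫⁻ x in (fun x => lam • R x - x₀) ⁻¹' A, ‖u₀ x‖ₑ ^ 3 = ∫⁻ x in A, ‖u₀ x‖ₑ ^ 3 := by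
  set B : EuclideanSpace ℝ (Fin 3) → EuclideanSpace ℝ (Fin 3) := fun x => lam • R x - x₀ with hB_def
  set d : ℝ≥0∞ := ENNReal.ofReal |(lam ^ 3)⁻¹| with hd_def
  have hS : MeasurePreserving (fun y : EuclideanSpace ℝ (Fin 3) => lam • y) volume (d • volume) := by
    refine ⟨measurable_const_smul lam, ?_⟩
    rw [Measure.map_addHaar_smul volume hlam.ne', finrank_euclideanSpace_fin]
  have hT : MeasurePreserving (fun y : EuclideanSpace ℝ (Fin 3) => y - x₀) (d • volume) (d • volume) :=
    (measurePreserving_sub_right volume x₀).smul_measure d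
  have hBmp : MeasurePreserving B volume (d • volume) := hT.comp (hS.comp R.measurePreserving)
  have hBemb : MeasurableEmbedding B :=
    (MeasurableEquiv.subRight x₀).measurableEmbedding.comp
      ((Homeomorph.smulOfNeZero lam hlam.ne').measurableEmbedding.comp
        R.toHomeomorph.measurableEmbedding)
  have hc : (‖lam‖ₑ ^ 3 : ℝ≥0∞) * d = 1 := by
    rw [hd_def, Real.enorm_eq_ofReal hlam.le, ← ENNReal.ofReal_pow hlam.le,
      abs_of_pos (by positivity), ← ENNReal.ofReal_mul (by positivity),
      mul_inv_cancel₀ (by positivity), ENNReal.ofReal_one]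
  have h1 : ∀ᵐ x ∂(volume : Measure (EuclideanSpace ℝ (Fin 3))),
      (‖u₀ x‖ₑ ^ 3 : ℝ≥0∞) = ‖lam‖ₑ ^ 3 * ‖u₀ (B x)‖ₑ ^ 3 := by
    filter_upwards [h] with x hx
    rw [← mul_pow, ← enorm_smul, hx, LinearIsometryEquiv.enorm_map]
  calc ∫⁻ x in B ⁻¹' A, ‖u₀ x‖ₑ ^ 3
      = ∫⁻ x in B ⁻¹' A, ‖lam‖ₑ ^ 3 * ‖u₀ (B x)‖ₑ ^ 3 := lintegral_congr_ae (ae_restrict_of_ae h1)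
    _ = ‖lam‖ₑ ^ 3 * ∫⁻ x in B ⁻¹' A, ‖u₀ (B x)‖ₑ ^ 3 :=
        lintegral_const_mul' _ _ (by simp)
    _ = ‖lam‖ₑ ^ 3 * ∫⁻ y in A, ‖u₀ y‖ₑ ^ 3 ∂(d • volume) :=
        congrArg (‖lam‖ₑ ^ 3 * ·)
          (hBmp.setLIntegral_comp_preimage_emb hBemb (fun y => ‖u₀ y‖ₑ ^ 3) A)
    _ = ‖lam‖ₑ ^ 3 * (d * ∫⁻ y in A, ‖u₀ y‖ₑ ^ 3) := by
        rw [setLIntegral_smul_measure, smul_eq_mul]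
    _ = ∫⁻ y in A, ‖u₀ y‖ₑ ^ 3 := by rw [← mul_assoc, hc, one_mul]

/-- **Scale rigidity, abstract form.** For a linear isometry equivalence `R` of `ℝ³`, `u₀ ∈ L³`,
`λ > 0` with `λ ≠ 1` and `x₀ ∈ ℝ³`: if `λ u₀ (λ R x − x₀) = R (u₀ x)` a.e., then `u₀ = 0` a.e.
Proof: `B x = λ R x − x₀` has a fixed point `x*` (`λ R − 1` is injective, hence surjective), the
cubic mass of balls about `x*` is invariant under `r ↦ r/λ`
(`scaleRigidity_setLIntegral_preimage_eq`), and continuity from above of the finite, absolutely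
continuous measure `∫ ‖u₀‖³` along the contracting direction kills every ball. [folklore] -/
theorem scaleRigidity_ae_eq_zero
    (R : EuclideanSpace ℝ (Fin 3) ≃ₗᵢ[ℝ] EuclideanSpace ℝ (Fin 3))
    {u₀ : EuclideanSpace ℝ (Fin 3) → EuclideanSpace ℝ (Fin 3)} (hu : MemLp u₀ 3 volume)
    {lam : ℝ} (hlam : 0 < lam) (hlam1 : lam ≠ 1) (x₀ : EuclideanSpace ℝ (Fin 3))
    (h : ∀ᵐ x ∂(volume : Measure (EuclideanSpace ℝ (Fin 3))), lam • u₀ (lam • R x - x₀) = R (u₀ x)) :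
    u₀ =ᵐ[volume] 0 := by
  -- (1) the fixed point of the similarity `B x = lam • R x - x₀`
  obtain ⟨xs, hxs⟩ : ∃ xs : EuclideanSpace ℝ (Fin 3), lam • R xs - xs = x₀ := by
    let L : EuclideanSpace ℝ (Fin 3) →ₗ[ℝ] EuclideanSpace ℝ (Fin 3) :=
      lam • (R.toLinearEquiv : EuclideanSpace ℝ (Fin 3) →ₗ[ℝ] EuclideanSpace ℝ (Fin 3)) - LinearMap.id
    have hL : ∀ x, L x = lam • R x - x := fun x => rfl
    have hinj : Function.Injective L := by
      refine (injective_iff_map_eq_zero L).mpr fun a ha => ?_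
      rw [hL, sub_eq_zero] at ha
      have hn : lam * ‖a‖ = ‖a‖ := by
        have hna := congrArg norm ha
        rwa [norm_smul, Real.norm_of_nonneg hlam.le, R.norm_map] at hna
      have hmul : (lam - 1) * ‖a‖ = 0 := by linarith
      rcases mul_eq_zero.mp hmul with h0 | h0
      · exact absurd (sub_eq_zero.mp h0) hlam1
      · exact norm_eq_zero.mp h0
    obtain ⟨xs, hxs⟩ := LinearMap.injective_iff_surjective.mp hinj x₀
    exact ⟨xs, by rw [← hL]; exact hxs⟩
  -- (2) the cubic mass of balls about `xs` is invariant under `r ↦ r / lam`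
  set F : ℝ → ℝ≥0∞ := fun r => ∫⁻ x in Metric.ball xs r, ‖u₀ x‖ₑ ^ 3 with hF_def
  have hpre : ∀ r : ℝ,
      (fun x => lam • R x - x₀) ⁻¹' Metric.ball xs r = Metric.ball xs (r / lam) := by
    intro r
    ext x
    simp only [Set.mem_preimage, Metric.mem_ball, dist_eq_norm]
    have hx : lam • R x - x₀ - xs = lam • R (x - xs) := by
      rw [map_sub, smul_sub, ← hxs]; abel
    rw [hx, norm_smul, Real.norm_of_nonneg hlam.le, R.norm_map, lt_div_iff₀ hlam, mul_comm]
  have hF1 : ∀ r, F (r / lam) = F r := fun r => by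
    simp only [hF_def]
    rw [← hpre r]
    exact scaleRigidity_setLIntegral_preimage_eq R u₀ hlam x₀ h _
  -- (3) the contracting direction `μ ∈ {lam, lam⁻¹}`, `0 < μ < 1`
  obtain ⟨μ, hμ0, hμ1, hμ⟩ : ∃ μ : ℝ, 0 < μ ∧ μ < 1 ∧ ∀ r, F (μ * r) = F r := by
    rcases lt_or_gt_of_ne hlam1 with hlt | hgt
    · refine ⟨lam, hlam, hlt, fun r => ?_⟩
      rw [← hF1 (lam * r), mul_div_cancel_left₀ r hlam.ne']
    · refine ⟨lam⁻¹, inv_pos.mpr hlam, inv_lt_one_of_one_lt₀ hgt, fun r => ?_⟩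
      rw [inv_mul_eq_div, hF1 r]
  have hFn : ∀ (n : ℕ) (r : ℝ), F (μ ^ n * r) = F r := by
    intro n
    induction n with
    | zero => intro r; rw [pow_zero, one_mul]
    | succ n ih => intro r; rw [pow_succ, mul_assoc, ih, hμ]
  -- (4) the finite measure `ν = ‖u₀‖ₑ³ • vol`
  have hfin : ∫⁻ x, ‖u₀ x‖ₑ ^ 3 ∂(volume : Measure (EuclideanSpace ℝ (Fin 3))) < ⊤ := by
    have h3 := lintegral_rpow_enorm_lt_top_of_eLpNorm_lt_top (by norm_num) (by norm_num)
      hu.eLpNorm_lt_top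
    simpa using h3
  set ν : Measure (EuclideanSpace ℝ (Fin 3)) := volume.withDensity (fun x => ‖u₀ x‖ₑ ^ 3)
    with hν_def
  have hνF : ∀ r, ν (Metric.ball xs r) = F r := fun r => withDensity_apply _ measurableSet_ball
  have hνuniv : ν univ = ∫⁻ x, ‖u₀ x‖ₑ ^ 3 := by
    rw [hν_def, withDensity_apply _ MeasurableSet.univ, Measure.restrict_univ]
  have hνfin : ∀ s, ν s ≠ ⊤ := fun s =>
    ne_top_of_le_ne_top (hνuniv ▸ hfin.ne) (measure_mono (subset_univ s))
  -- (5) every ball about `xs` is `ν`-null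
  have hF0 : ∀ r, 0 < r → F r = 0 := by
    intro r hr
    set s : ℕ → Set (EuclideanSpace ℝ (Fin 3)) := fun n => Metric.ball xs (μ ^ n * r) with hs_def
    have hanti : Antitone s := fun n m hnm =>
      Metric.ball_subset_ball
        (mul_le_mul_of_nonneg_right (pow_le_pow_of_le_one hμ0.le hμ1.le hnm) hr.le)
    have ht := tendsto_measure_iInter_atTop (μ := ν)
      (fun n => (measurableSet_ball (x := xs) (ε := μ ^ n * r)).nullMeasurableSet) hanti
      ⟨0, hνfin _⟩
    have hconst : ν ∘ s = fun _ => F r := by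
      funext n
      show ν (Metric.ball xs (μ ^ n * r)) = F r
      rw [hνF, hFn]
    rw [hconst] at ht
    rw [tendsto_nhds_unique tendsto_const_nhds ht]
    refine measure_mono_null (t := {xs}) (fun y hy => ?_) ?_
    · rw [Set.mem_singleton_iff]
      by_contra hne
      have hd : 0 < dist y xs := dist_pos.mpr hne
      obtain ⟨n, hn⟩ := exists_pow_lt_of_lt_one (div_pos hd hr) hμ1
      have hyn : y ∈ s n := Set.mem_iInter.mp hy n
      rw [hs_def, Metric.mem_ball] at hyn
      exact lt_irrefl _ (hyn.trans ((lt_div_iff₀ hr).mp hn))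
    · exact withDensity_absolutelyContinuous _ _ (measure_singleton xs)
  -- (6) hence `ν = 0` and `u₀ = 0` a.e.
  have hν0 : ν univ = 0 := by
    rw [← Metric.iUnion_ball_nat_succ xs]
    exact measure_iUnion_null fun n => by rw [hνF]; exact hF0 _ (by positivity)
  have hae : (fun x => (‖u₀ x‖ₑ ^ 3 : ℝ≥0∞)) =ᵐ[volume] 0 :=
    (lintegral_eq_zero_iff' (hu.aestronglyMeasurable.enorm.pow_const 3)).mp (hνuniv ▸ hν0)
  filter_upwards [hae] with x hx
  simpa using hx

/-- **Scale rigidity of a minimal datum fixed modulo `Sim` by a rotation** (crux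
`MinimalDatumPFold`, registered line, stub `stub_liftScaleRigidity`). Let `u₀ ∈ L³(ℝ³; ℝ³)` be
non-trivial (`¬ u₀ = 0` a.e.), `λ > 0`, `x₀ ∈ ℝ³`, and let `R = R_{2π/p}` be the rotation by
`2π/p` about the `x₂`-axis, written out in coordinates. If
`λ u₀ (λ R x − x₀) = R (u₀ x)` for a.e. `x` (the datum is fixed by `R` modulo the Navier–Stokes
similarity `u ↦ λ u(λ · − x₀)`, `Literature.Analysis.FluidPDE.rescaleData`), then `λ = 1`.
Proof: the written-out rotation is `Literature.Analysis.FluidPDE.rotZ (2π/p)` definitionally; it is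
packaged as a linear isometry equivalence (`rotZ_add`, `rotZ_zero`, `norm_rotZ`) and
`scaleRigidity_ae_eq_zero` (fixed point of the similarity + Jacobian count `λ³ · λ⁻³ = 1` +
continuity from above of the finite measure `∫ ‖u₀‖³` along the contracting direction) shows that
`λ ≠ 1` would force `u₀ = 0` a.e. [folklore] -/
theorem stub_liftScaleRigidity :
    ∀ (p : ℕ) (u₀ : EuclideanSpace ℝ (Fin 3) → EuclideanSpace ℝ (Fin 3)), MeasureTheory.MemLp u₀ 3 (MeasureTheory.volume : MeasureTheory.Measure (EuclideanSpace ℝ (Fin 3))) → ¬ (u₀ =ᵐ[(MeasureTheory.volume : MeasureTheory.Measure (EuclideanSpace ℝ (Fin 3)))] (0 : EuclideanSpace ℝ (Fin 3) → EuclideanSpace ℝ (Fin 3))) → ∀ (lam : ℝ) (x₀ : EuclideanSpace ℝ (Fin 3)), 0 < lam → (∀ᵐ x ∂(MeasureTheory.volume : MeasureTheory.Measure (EuclideanSpace ℝ (Fin 3))), Literature.Analysis.FluidPDE.rescaleData lam (fun y => u₀ (y - x₀)) (WithLp.toLp 2 ![Real.cos (2 * Real.pi / p) * x 0 - Real.sin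 (2 * Real.pi / p) * x 1, Real.sin (2 * Real.pi / p) * x 0 + Real.cos (2 * Real.pi / p) * x 1, x 2]) = WithLp.toLp 2 ![Real.cos (2 * Real.pi / p) * u₀ x 0 - Real.sin (2 * Real.pi / p) * u₀ x 1, Real.sin (2 * Real.pi / p) * u₀ x 0 + Real.cos (2 * Real.pi / p) * u₀ x 1, u₀ x 2]) → lam = 1 := by
  intro p u₀ hu h0 lam x₀ hlam h
  by_contra hne
  apply h0
  -- the rotation by `θ = 2π/p` about the axis as a linear isometry equivalence
  let Rₗ : EuclideanSpace ℝ (Fin 3) ≃ₗᵢ[ℝ] EuclideanSpace ℝ (Fin 3) :=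
    { toFun := Literature.Analysis.FluidPDE.rotZ (2 * Real.pi / p)
      map_add' := fun v w => by
        ext i; fin_cases i <;> (simp [Literature.Analysis.FluidPDE.rotZ]; try ring)
      map_smul' := fun c v => by
        ext i; fin_cases i <;> (simp [Literature.Analysis.FluidPDE.rotZ]; try ring)
      invFun := Literature.Analysis.FluidPDE.rotZ (-(2 * Real.pi / p))
      left_inv := fun v => by
        rw [← Literature.Analysis.FluidPDE.rotZ_add, neg_add_cancel,
          Literature.Analysis.FluidPDE.rotZ_zero]
      right_inv := fun v => by
        rw [← Literature.Analysis.FluidPDE.rotZ_add, add_neg_cancel,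
          Literature.Analysis.FluidPDE.rotZ_zero]
      norm_map' := Literature.Analysis.FluidPDE.norm_rotZ _ }
  exact scaleRigidity_ae_eq_zero Rₗ hu hlam hne x₀ h

end Summit.NavierStokesRegularity.NavierStokesRegularity.Theorems

end
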